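import Summits.QuantumFields.YangMills.Theorems.WeakCouplingRatesColdBoxPlaqVariance
import Summits.QuantumFields.YangMills.Theorems.WeakCouplingRatesColdBoxColours
import Summits.QuantumFields.YangMills.Theorems.WeakCouplingRatesColdBoxGoodEvent

/-!
# Crux `BulkDominatesColdBoxW` (stmt-QuantumFields-19609), interface `KernelMeanExpansion` of stub L1b: the GAUSSIAN SIDE of the
# one-scale expansion of a kernel MEAN — the mean-shifted three-colour Dirichlet Gaussian evaluates the quadratic plaquette observable
# to `(3/2)·V_D(q) + ½Σ_c F̄_c(q)²`, exactly, and up to `O(√η)` after restriction to any likely event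

Census v3 of the line `dlr-chessboard` (item evidence #12), brick table §4 / PLAN-S3c-ii (R5–R6): after the forest gauge, the chart and the
rescaling `t = √(2β)·v`, the box kernel with a small datum is a bounded tilt of the law `P = boxDirichlet H ^{⊗3}` (three colour
components) SHIFTED by the means `μ_c = mean(ϑ_c)` of the one-colour data `ϑ_c`, restricted to a small-field event `G̃`; the leading
observable is `f₂(t) = ½ Σ_c s_c(q)²` with `s_c = sCirc (glue ϑ_c (μ_c + t_c))`.  This file supplies the Gaussian evaluation the
assembler consumes:

* `sCirc_glue_add_ofLp` — the circulation is affine: `sCirc (glue ϑ (u + t)) q = sCirc (glue ϑ u) q + dirCirc H q t`, so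
  `s_c(q) = F̄_c(q) + X_c` with `F̄_c(q) = sCirc (glue ϑ_c μ_c) q` (the background circulation) and `X_c = dirCirc H q t_c`;
* one colour: `integral_const_add_dirCirc_sq` (`E_D[(F + X)²] = F² + V_D(q)`, `V_D(q) = boxDirProjKernel H q q`),
  `integral_dirCirc_pow_four` (`E_D[X⁴] = 3V_D(q)²`, Wick), `integral_const_add_dirCirc_pow_four_le` (`E_D[(F+X)⁴] ≤ 8(F⁴ + 3V_D(q)²)`);
* three colours (`Measure.pi`): **`integral_quadObs_pi_eq`** — `E_P[½Σ_c (F_c + X_c)²] = (3/2)·V_D(q) + ½Σ_c F_c²` EXACTLY — and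
  `integral_quadObs_sq_pi_le` (`E_P[f₂²] ≤ 6Σ_c(F_c⁴ + 3V_D(q)²)`);
* `abs_integral_sub_integral_cond_le_of_sq` — **conditioning an `L²` observable on a likely event** (general probability space):
  `|E[X] − E[X | G]| ≤ 2(1 + E[X²])·√η` whenever `P(Gᶜ) ≤ η ≤ 1/2` (the `L∞` version is `abs_integral_sub_integral_cond_le`);
* **`abs_integral_cond_quadObs_sub_le`** — hence for ANY measurable `G̃` with `P(G̃ᶜ) ≤ η ≤ 1/2`:
  `|E_P[f₂ | G̃] − (3/2)·V_D(q) − ½Σ_c F_c²| ≤ 2(1 + 6Σ_c(F_c⁴ + 3V_D(q)²))·√η`;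
* `abs_integral_cond_quadObs_datum_sub_le` — the same written with the data `ϑ : Fin 3 → (edges → ℝ)` and their means, i.e. with
  `F_c = sCirc (glue ϑ_c (mean ϑ_c)) q` and the observable `½Σ_c (sCirc (glue ϑ_c (mean ϑ_c + t_c)) q)²` — the form of `KernelMeanExpansion`
  (there `ϑ_c ↦ √(2β)ϑ_c`, so `½F̄² = β·F̄_unscaled²` by `mean_smul`).

Fleet seat `ym-spine-20043-p1` (g3, re-targeted to R2ξ by director-ym LINE №76/№78; line lead `ym-wcr-19609-p1`).  No sorry, standard axioms, no
new definition, no named-fact hypothesis.  NOT a claim about the mass gap: statements about a finite-dimensional Gaussian.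
-/

set_option autoImplicit false

noncomputable section

open MeasureTheory ProbabilityTheory Finset Matrix Real
open Literature.Probability.LatticeModels
open Literature.MathematicalPhysics.QuantumLattice
open Literature.MathematicalPhysics.QuantumFieldTheory
open Literature.MathematicalPhysics.QuantumFieldTheory.LatticeMaxwell
open Literature.MathematicalPhysics.QuantumFieldTheory.AxialGauge

namespace Summit.QuantumFields.YangMills.Theorems.WeakCouplingRates

/-! ## §1 Conditioning an `L²` observable on a likely event -/

section CondL2

variable {Ω : Type*} [MeasurableSpace Ω] {μ : Measure Ω} [IsProbabilityMeasure μ] {G : Set Ω}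

/-- **Conditioning on a likely event moves an `L²` expectation by `O(√(μ(bad)))`**: if `μ(Gᶜ) ≤ η ≤ 1/2` and `X ∈ L²(μ)` then
`|E[X] − E[X | G]| ≤ 2(1 + E[X²])·√η` (Cauchy–Schwarz on the bad event; `|E[X]| ≤ (1 + E[X²])/2`). -/
theorem abs_integral_sub_integral_cond_le_of_sq (hG : MeasurableSet G) {X : Ω → ℝ} (hX : MemLp X 2 μ)
    {η : ℝ} (hη : μ.real Gᶜ ≤ η) (hη2 : η ≤ 1 / 2) :
    |(∫ ω, X ω ∂μ) - ∫ ω, X ω ∂(μ[|G])| ≤ 2 * (1 + ∫ ω, X ω ^ 2 ∂μ) * Real.sqrt η := by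
  have hXi : Integrable X μ := hX.integrable one_le_two
  have hX2 : Integrable (fun ω => X ω ^ 2) μ := hX.integrable_sq
  have hη0 : 0 ≤ η := le_trans measureReal_nonneg hη
  set p : ℝ := μ.real G with hp
  set q : ℝ := μ.real Gᶜ with hq
  set a : ℝ := ∫ ω in G, X ω ∂μ with ha
  set b : ℝ := ∫ ω in Gᶜ, X ω ∂μ with hb
  set S : ℝ := ∫ ω, X ω ^ 2 ∂μ with hS
  have hS0 : 0 ≤ S := integral_nonneg fun ω => sq_nonneg _
  have hpq : p + q = 1 := by rw [hp, hq, measureReal_add_measureReal_compl hG, probReal_univ]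
  have hq0 : 0 ≤ q := measureReal_nonneg
  have hp0 : 0 < p := by linarith
  have hG0 : μ G ≠ 0 := by
    intro h0
    have : p = 0 := by rw [hp, measureReal_def, h0, ENNReal.toReal_zero]
    linarith
  have hsplit : ∫ ω, X ω ∂μ = a + b := (integral_add_compl hG hXi).symm
  have hcond : ∫ ω, X ω ∂(μ[|G]) = p⁻¹ * a := integral_cond_eq G X
  -- the identity `E X − E[X|G] = (b − E X · q)/p`
  have key : (∫ ω, X ω ∂μ) - ∫ ω, X ω ∂(μ[|G]) = (b - (∫ ω, X ω ∂μ) * q) / p := by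
    rw [hcond, hsplit]
    field_simp
    linear_combination (a + b) * hpq
  -- Cauchy–Schwarz on the bad event: `|b| ≤ √S · √q`
  have hb_le : |b| ≤ Real.sqrt S * Real.sqrt q := by
    have h1 : |b| ≤ ∫ ω in Gᶜ, |X ω| ∂μ := abs_integral_le_integral_abs
    have h2 : ∫ ω in Gᶜ, |X ω| ∂μ = ∫ ω, |X ω| * (Gᶜ).indicator (fun _ => (1 : ℝ)) ω ∂μ := by
      rw [← integral_indicator hG.compl]
      refine integral_congr_ae (ae_of_all _ fun ω => ?_)
      by_cases hω : ω ∈ Gᶜ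
      · simp [Set.indicator_of_mem hω]
      · simp [Set.indicator_of_notMem hω]
    have hind : MemLp ((Gᶜ).indicator fun _ => (1 : ℝ)) (ENNReal.ofReal 2) μ := by
      rw [show ENNReal.ofReal 2 = 2 by norm_num]
      exact (memLp_const 1).indicator hG.compl
    have habs : MemLp (fun ω => |X ω|) (ENNReal.ofReal 2) μ := by
      rw [show ENNReal.ofReal 2 = 2 by norm_num]; exact hX.abs
    have h3 := integral_mul_le_Lp_mul_Lq_of_nonneg (μ := μ) Real.HolderConjugate.two_two
      (ae_of_all _ fun ω => abs_nonneg (X ω))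
      (ae_of_all _ fun ω => Set.indicator_nonneg (fun _ _ => zero_le_one) ω) habs hind
    have h4 : ∫ ω, |X ω| ^ (2 : ℝ) ∂μ = S := by
      rw [hS]; refine integral_congr_ae (ae_of_all _ fun ω => ?_)
      simp only [Real.rpow_two, sq_abs]
    have h5 : ∫ ω, ((Gᶜ).indicator (fun _ => (1 : ℝ)) ω) ^ (2 : ℝ) ∂μ = q := by
      have : ∀ ω, ((Gᶜ).indicator (fun _ => (1 : ℝ)) ω) ^ (2 : ℝ) = (Gᶜ).indicator (fun _ => (1 : ℝ)) ω := by
        intro ω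
        by_cases hω : ω ∈ Gᶜ
        · simp [Set.indicator_of_mem hω]
        · simp [Set.indicator_of_notMem hω]
      simp_rw [this]
      rw [integral_indicator_const _ hG.compl, hq, smul_eq_mul, mul_one]
    rw [h4, h5] at h3
    rw [h2] at h1
    refine h1.trans (h3.trans (le_of_eq ?_))
    rw [Real.sqrt_eq_rpow, Real.sqrt_eq_rpow]
  have hsq : Real.sqrt q ≤ Real.sqrt η := Real.sqrt_le_sqrt hη
  have hη_le_sqrt : η ≤ Real.sqrt η := by
    have h1 : Real.sqrt η ≤ 1 := by rw [Real.sqrt_le_one]; linarith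
    calc η = Real.sqrt η * Real.sqrt η := (Real.mul_self_sqrt hη0).symm
      _ ≤ Real.sqrt η * 1 := mul_le_mul_of_nonneg_left h1 (Real.sqrt_nonneg _)
      _ = Real.sqrt η := mul_one _
  -- `√S ≤ (1 + S)/2` and `|E X| ≤ (1 + S)/2`
  have hsqrtS : Real.sqrt S ≤ (1 + S) / 2 := by
    nlinarith [Real.sq_sqrt hS0, Real.sqrt_nonneg S, sq_nonneg (Real.sqrt S - 1)]
  have hint_le : |∫ ω, X ω ∂μ| ≤ (1 + S) / 2 := by
    have h1 : |∫ ω, X ω ∂μ| ≤ ∫ ω, |X ω| ∂μ := abs_integral_le_integral_abs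
    have h2 : ∫ ω, |X ω| ∂μ ≤ ∫ ω, (1 + X ω ^ 2) / 2 ∂μ := by
      refine integral_mono hXi.abs (((integrable_const (1 : ℝ)).add hX2).div_const 2) fun ω => ?_
      have e : X ω ^ 2 = |X ω| ^ 2 := (sq_abs _).symm
      simp only [e]
      nlinarith [sq_nonneg (|X ω| - 1)]
    have h3 : ∫ ω, (1 + X ω ^ 2) / 2 ∂μ = (1 + S) / 2 := by
      rw [integral_div, integral_add (integrable_const _) hX2, integral_const, hS, smul_eq_mul, probReal_univ, one_mul]
    linarith
  -- assemble
  rw [key, abs_div, abs_of_pos hp0, div_le_iff₀ hp0]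
  have t1 : |b| ≤ (1 + S) / 2 * Real.sqrt η :=
    hb_le.trans (mul_le_mul hsqrtS hsq (Real.sqrt_nonneg _) (by linarith))
  have t2 : |(∫ ω, X ω ∂μ) * q| ≤ (1 + S) / 2 * Real.sqrt η := by
    rw [abs_mul, abs_of_nonneg hq0]
    exact mul_le_mul hint_le (hη.trans hη_le_sqrt) hq0 (by linarith)
  have t3 := (abs_sub _ _).trans (add_le_add t1 t2)
  have hp12 : 1 / 2 ≤ p := by linarith
  have h1S : 0 ≤ (1 + S) * Real.sqrt η := mul_nonneg (by linarith) (Real.sqrt_nonneg η)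
  nlinarith

end CondL2

/-! ## §2 One colour: the shifted Dirichlet circulation -/

section OneColour

variable {H : ℕ}

/-- **The circulation is affine in the free variables**: shifting the free variables by `t` adds the homogeneous circulation
`dirCirc H q t` — `sCirc (glue ϑ (u + t)) q = sCirc (glue ϑ u) q + dirCirc H q t`. -/
theorem sCirc_glue_add_ofLp (ϑ : Literature.MathematicalPhysics.QuantumLattice.ZdEdge 4 → ℝ) (u : DirFree H → ℝ)
    (t : EuclideanSpace ℝ (DirFree H)) (q : Plaq 4) :
    sCirc (glue (pin := fun e => e ∉ dirFreeEdges H) dirCorner (2 * H + 3) ϑ (u + WithLp.ofLp t)) q =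
      sCirc (glue (pin := fun e => e ∉ dirFreeEdges H) dirCorner (2 * H + 3) ϑ u) q + dirCirc H q t := by
  rw [sCirc_glue, sCirc_glue, dirCirc_apply, sCirc_glue_zero_eq_dotProduct, dotProduct_add]
  ring

/-- `dirCirc H q` is square integrable (Gaussian). -/
theorem memLp_two_dirCirc (q : Plaq 4) : MemLp (dirCirc H q) 2 (boxDirichlet H) :=
  ((isGaussianProcess_dirCirc H).hasGaussianLaw_eval q).memLp_two

/-- `dirCirc H q` has a fourth moment (Gaussian). -/
theorem memLp_four_dirCirc (q : Plaq 4) : MemLp (dirCirc H q) 4 (boxDirichlet H) :=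
  ((isGaussianProcess_dirCirc H).hasGaussianLaw_eval q).memLp (by norm_num)

/-- The Dirichlet variance of a plaquette is the diagonal of the projection kernel: `E_D[X_q²] = V_D(q) = boxDirProjKernel H q q`. -/
theorem integral_dirCirc_sq (q : Plaq 4) :
    ∫ t, dirCirc H q t ^ 2 ∂(boxDirichlet H) = boxDirProjKernel H q q := by
  have h := integral_dirCirc_mul (H := H) q q
  simp_rw [← sq] at h
  rw [h]; rfl

/-- `V_D(q) ≥ 0`. -/
theorem boxDirProjKernel_self_nonneg (q : Plaq 4) : 0 ≤ boxDirProjKernel H q q := by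
  rw [← integral_dirCirc_sq]; exact integral_nonneg fun t => sq_nonneg _

/-- **Shifted second moment**: `E_D[(F + X_q)²] = F² + V_D(q)` for every constant `F`. -/
theorem integral_const_add_dirCirc_sq (F : ℝ) (q : Plaq 4) :
    ∫ t, (F + dirCirc H q t) ^ 2 ∂(boxDirichlet H) = F ^ 2 + boxDirProjKernel H q q := by
  have hX : Integrable (dirCirc H q) (boxDirichlet H) := (memLp_two_dirCirc q).integrable one_le_two
  have hX2 : Integrable (fun t => dirCirc H q t ^ 2) (boxDirichlet H) := (memLp_two_dirCirc q).integrable_sq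
  have hsplit : ∀ t, (F + dirCirc H q t) ^ 2 = F ^ 2 + (2 * F * dirCirc H q t + dirCirc H q t ^ 2) := fun t => by ring
  simp_rw [hsplit]
  have hlin : Integrable (fun t => 2 * F * dirCirc H q t) (boxDirichlet H) := hX.const_mul _
  have hsum : Integrable (fun t => 2 * F * dirCirc H q t + dirCirc H q t ^ 2) (boxDirichlet H) := hlin.add hX2
  rw [integral_add (f := fun _ => F ^ 2) (g := fun t => 2 * F * dirCirc H q t + dirCirc H q t ^ 2) (integrable_const _) hsum,
    integral_add (f := fun t => 2 * F * dirCirc H q t) (g := fun t => dirCirc H q t ^ 2) hlin hX2, integral_const_mul,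
    integral_dirCirc, integral_dirCirc_sq, integral_const, smul_eq_mul, probReal_univ]
  ring

/-- **Fourth moment (Wick)**: `E_D[X_q⁴] = 3·V_D(q)²`. -/
theorem integral_dirCirc_pow_four (q : Plaq 4) :
    ∫ t, dirCirc H q t ^ 4 ∂(boxDirichlet H) = 3 * boxDirProjKernel H q q ^ 2 := by
  have h := integral_dirCirc_sq_mul_sq_sub (H := H) q q
  have h4 : ∀ t, dirCirc H q t ^ 2 * dirCirc H q t ^ 2 = dirCirc H q t ^ 4 := fun t => by ring
  simp_rw [h4, ← sq, integral_dirCirc_sq] at h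
  linarith

/-- **Shifted fourth moment**: `E_D[(F + X_q)⁴] ≤ 8(F⁴ + 3V_D(q)²)`. -/
theorem integral_const_add_dirCirc_pow_four_le (F : ℝ) (q : Plaq 4) :
    ∫ t, (F + dirCirc H q t) ^ 4 ∂(boxDirichlet H) ≤ 8 * (F ^ 4 + 3 * boxDirProjKernel H q q ^ 2) := by
  have hX4 : Integrable (fun t => dirCirc H q t ^ 4) (boxDirichlet H) := by
    refine ((memLp_four_dirCirc q).integrable_norm_pow (by norm_num)).congr (ae_of_all _ fun t => ?_)
    simp only [Real.norm_eq_abs]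
    exact (show Even 4 by decide).pow_abs _
  have hFX : MemLp (fun t => F + dirCirc H q t) 4 (boxDirichlet H) := (memLp_const F).add (memLp_four_dirCirc q)
  have hint4 : Integrable (fun t => (F + dirCirc H q t) ^ 4) (boxDirichlet H) := by
    refine (hFX.integrable_norm_pow (by norm_num)).congr (ae_of_all _ fun t => ?_)
    simp only [Real.norm_eq_abs]
    exact (show Even 4 by decide).pow_abs _
  have hpt : ∀ t, (F + dirCirc H q t) ^ 4 ≤ 8 * (F ^ 4 + dirCirc H q t ^ 4) := fun t => by
    have h1 : (F + dirCirc H q t) ^ 2 ≤ 2 * (F ^ 2 + dirCirc H q t ^ 2) := by nlinarith [sq_nonneg (F - dirCirc H q t)]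
    have h2 : (F ^ 2 + dirCirc H q t ^ 2) ^ 2 ≤ 2 * (F ^ 4 + dirCirc H q t ^ 4) := by
      nlinarith [sq_nonneg (F ^ 2 - dirCirc H q t ^ 2)]
    have h0 : 0 ≤ (F + dirCirc H q t) ^ 2 := sq_nonneg _
    calc (F + dirCirc H q t) ^ 4 = ((F + dirCirc H q t) ^ 2) ^ 2 := by ring
      _ ≤ (2 * (F ^ 2 + dirCirc H q t ^ 2)) ^ 2 := pow_le_pow_left₀ h0 h1 2
      _ = 4 * (F ^ 2 + dirCirc H q t ^ 2) ^ 2 := by ring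
      _ ≤ 8 * (F ^ 4 + dirCirc H q t ^ 4) := by linarith
  calc ∫ t, (F + dirCirc H q t) ^ 4 ∂(boxDirichlet H) ≤ ∫ t, 8 * (F ^ 4 + dirCirc H q t ^ 4) ∂(boxDirichlet H) :=
        integral_mono hint4 (((integrable_const _).add hX4).const_mul 8) hpt
    _ = 8 * (F ^ 4 + 3 * boxDirProjKernel H q q ^ 2) := by
        rw [integral_const_mul, integral_add (integrable_const _) hX4, integral_const, integral_dirCirc_pow_four,
          smul_eq_mul, probReal_univ, one_mul]

end OneColour

/-! ## §3 Three colours under the product measure -/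

section ThreeColours

variable {H : ℕ}

/-- Integrability transfers from one colour to the product: `t ↦ g(t_c)` is integrable under `D^{⊗3}` if `g` is under `D`. -/
theorem integrable_comp_eval_pi {g : EuclideanSpace ℝ (DirFree H) → ℝ} (hg : Integrable g (boxDirichlet H)) (c : Fin 3) :
    Integrable (fun t : Fin 3 → EuclideanSpace ℝ (DirFree H) => g (t c)) (Measure.pi fun _ : Fin 3 => boxDirichlet H) := by
  have hmp := MeasureTheory.measurePreserving_eval (μ := fun _ : Fin 3 => boxDirichlet H) c
  exact (hmp.integrable_comp hg.aestronglyMeasurable).2 hg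

/-- **Three colours, exact mean**: `E_{D^{⊗3}}[½Σ_c (F_c + X_q(t_c))²] = (3/2)·V_D(q) + ½Σ_c F_c²`. -/
theorem integral_quadObs_pi_eq (F : Fin 3 → ℝ) (q : Plaq 4) :
    ∫ t : Fin 3 → EuclideanSpace ℝ (DirFree H), (1 / 2 : ℝ) * ∑ c, (F c + dirCirc H q (t c)) ^ 2
        ∂(Measure.pi fun _ : Fin 3 => boxDirichlet H) =
      3 / 2 * boxDirProjKernel H q q + 1 / 2 * ∑ c, F c ^ 2 := by
  have hint : ∀ c : Fin 3, Integrable (fun t : Fin 3 → EuclideanSpace ℝ (DirFree H) => (F c + dirCirc H q (t c)) ^ 2)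
      (Measure.pi fun _ : Fin 3 => boxDirichlet H) := fun c =>
    integrable_comp_eval_pi (((memLp_const (F c)).add (memLp_two_dirCirc q)).integrable_sq) c
  rw [integral_const_mul, integral_finsetSum _ fun c _ => hint c]
  have hc : ∀ c : Fin 3, ∫ t : Fin 3 → EuclideanSpace ℝ (DirFree H), (F c + dirCirc H q (t c)) ^ 2
      ∂(Measure.pi fun _ : Fin 3 => boxDirichlet H) = F c ^ 2 + boxDirProjKernel H q q := fun c => by
    rw [integral_pi_eval (boxDirichlet H) (fun s => (F c + dirCirc H q s) ^ 2) c, integral_const_add_dirCirc_sq]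
  simp_rw [hc]
  rw [Finset.sum_add_distrib, Finset.sum_const, Finset.card_univ, Fintype.card_fin]
  simp only [nsmul_eq_mul, Nat.cast_ofNat]
  ring

/-- **Three colours, second moment**: `E_{D^{⊗3}}[(½Σ_c (F_c + X_q(t_c))²)²] ≤ 6Σ_c (F_c⁴ + 3V_D(q)²)`. -/
theorem integral_quadObs_sq_pi_le (F : Fin 3 → ℝ) (q : Plaq 4) :
    ∫ t : Fin 3 → EuclideanSpace ℝ (DirFree H), ((1 / 2 : ℝ) * ∑ c, (F c + dirCirc H q (t c)) ^ 2) ^ 2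
        ∂(Measure.pi fun _ : Fin 3 => boxDirichlet H) ≤
      6 * ∑ c, (F c ^ 4 + 3 * boxDirProjKernel H q q ^ 2) := by
  set P := Measure.pi fun _ : Fin 3 => boxDirichlet H with hP
  have hint4 : ∀ c : Fin 3, Integrable (fun t : Fin 3 → EuclideanSpace ℝ (DirFree H) => (F c + dirCirc H q (t c)) ^ 4) P := by
    intro c
    have hFX : MemLp (fun s => F c + dirCirc H q s) 4 (boxDirichlet H) := (memLp_const (F c)).add (memLp_four_dirCirc q)
    have h1 : Integrable (fun s => (F c + dirCirc H q s) ^ 4) (boxDirichlet H) := by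
      refine (hFX.integrable_norm_pow (by norm_num)).congr (ae_of_all _ fun t => ?_)
      simp only [Real.norm_eq_abs]
      exact (show Even 4 by decide).pow_abs _
    exact integrable_comp_eval_pi h1 c
  -- pointwise Cauchy–Schwarz: `(½Σ_c Y_c)² ≤ ¾ Σ_c Y_c²`, `Y_c = (F_c + X_c)² ≥ 0`, `Y_c² = (F_c+X_c)⁴`
  have hpt : ∀ t : Fin 3 → EuclideanSpace ℝ (DirFree H),
      ((1 / 2 : ℝ) * ∑ c, (F c + dirCirc H q (t c)) ^ 2) ^ 2 ≤ 3 / 4 * ∑ c, (F c + dirCirc H q (t c)) ^ 4 := by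
    intro t
    simp only [Fin.sum_univ_three]
    nlinarith [sq_nonneg ((F 0 + dirCirc H q (t 0)) ^ 2 - (F 1 + dirCirc H q (t 1)) ^ 2),
      sq_nonneg ((F 1 + dirCirc H q (t 1)) ^ 2 - (F 2 + dirCirc H q (t 2)) ^ 2),
      sq_nonneg ((F 0 + dirCirc H q (t 0)) ^ 2 - (F 2 + dirCirc H q (t 2)) ^ 2)]
  have hsq_int : Integrable (fun t : Fin 3 → EuclideanSpace ℝ (DirFree H) =>
      ((1 / 2 : ℝ) * ∑ c, (F c + dirCirc H q (t c)) ^ 2) ^ 2) P := by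
    refine Integrable.mono' ((integrable_finsetSum Finset.univ fun c _ => hint4 c).const_mul (3 / 4)) ?_ (ae_of_all _ fun t => ?_)
    · refine (AEStronglyMeasurable.pow ?_ 2)
      refine AEStronglyMeasurable.const_mul (Finset.aestronglyMeasurable_fun_sum _ fun c _ => ?_) _
      exact ((integrable_comp_eval_pi (((memLp_const (F c)).add (memLp_two_dirCirc q)).integrable_sq) c)).aestronglyMeasurable
    · rw [Real.norm_eq_abs, abs_of_nonneg (sq_nonneg _)]
      exact hpt t
  calc ∫ t, ((1 / 2 : ℝ) * ∑ c, (F c + dirCirc H q (t c)) ^ 2) ^ 2 ∂P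
      ≤ ∫ t, 3 / 4 * ∑ c, (F c + dirCirc H q (t c)) ^ 4 ∂P :=
        integral_mono hsq_int ((integrable_finsetSum Finset.univ fun c _ => hint4 c).const_mul _) hpt
    _ = 3 / 4 * ∑ c, ∫ t, (F c + dirCirc H q (t c)) ^ 4 ∂P := by
        rw [integral_const_mul, integral_finsetSum _ fun c _ => hint4 c]
    _ = 3 / 4 * ∑ c, ∫ s, (F c + dirCirc H q s) ^ 4 ∂(boxDirichlet H) := by
        congr 1
        refine Finset.sum_congr rfl fun c _ => ?_
        exact integral_pi_eval (boxDirichlet H) (fun s => (F c + dirCirc H q s) ^ 4) c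
    _ ≤ 3 / 4 * ∑ c, 8 * (F c ^ 4 + 3 * boxDirProjKernel H q q ^ 2) := by
        gcongr with c _
        exact integral_const_add_dirCirc_pow_four_le (F c) q
    _ = 6 * ∑ c, (F c ^ 4 + 3 * boxDirProjKernel H q q ^ 2) := by
        rw [← Finset.mul_sum]; ring

/-- One colour of the quadratic observable is square integrable under the product measure. -/
theorem memLp_two_const_add_dirCirc_sq_pi (F : ℝ) (q : Plaq 4) (c : Fin 3) :
    MemLp (fun t : Fin 3 → EuclideanSpace ℝ (DirFree H) => (F + dirCirc H q (t c)) ^ 2) 2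
      (Measure.pi fun _ : Fin 3 => boxDirichlet H) := by
  have hFX : MemLp (fun s => F + dirCirc H q s) 4 (boxDirichlet H) := (memLp_const F).add (memLp_four_dirCirc q)
  have h1 : Integrable (fun s => (F + dirCirc H q s) ^ 4) (boxDirichlet H) := by
    refine (hFX.integrable_norm_pow (by norm_num)).congr (ae_of_all _ fun t => ?_)
    simp only [Real.norm_eq_abs]
    exact (show Even 4 by decide).pow_abs _
  have h4 : Integrable (fun t : Fin 3 → EuclideanSpace ℝ (DirFree H) => (F + dirCirc H q (t c)) ^ 4)
      (Measure.pi fun _ : Fin 3 => boxDirichlet H) := integrable_comp_eval_pi h1 c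
  have h2 : Integrable (fun t : Fin 3 → EuclideanSpace ℝ (DirFree H) => (F + dirCirc H q (t c)) ^ 2)
      (Measure.pi fun _ : Fin 3 => boxDirichlet H) :=
    integrable_comp_eval_pi (((memLp_const F).add (memLp_two_dirCirc q)).integrable_sq) c
  rw [memLp_two_iff_integrable_sq h2.aestronglyMeasurable]
  refine h4.congr (ae_of_all _ fun t => ?_)
  simp only
  ring

/-- The quadratic observable is square integrable under the product measure. -/
theorem memLp_two_quadObs_pi (F : Fin 3 → ℝ) (q : Plaq 4) :
    MemLp (fun t : Fin 3 → EuclideanSpace ℝ (DirFree H) => (1 / 2 : ℝ) * ∑ c, (F c + dirCirc H q (t c)) ^ 2) 2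
      (Measure.pi fun _ : Fin 3 => boxDirichlet H) :=
  (memLp_finsetSum Finset.univ fun c _ => memLp_two_const_add_dirCirc_sq_pi (F c) q c).const_mul _

/-- **Gaussian evaluation after restriction to a likely event.**  For every measurable `G̃` of the three-colour space with
`D^{⊗3}(G̃ᶜ) ≤ η ≤ 1/2`:  `|E_{D^{⊗3}}[½Σ_c (F_c + X_q(t_c))² | G̃] − (3/2)·V_D(q) − ½Σ_c F_c²| ≤ 2(1 + 6Σ_c(F_c⁴ + 3V_D(q)²))·√η`. -/
theorem abs_integral_cond_quadObs_sub_le (F : Fin 3 → ℝ) (q : Plaq 4)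
    {G : Set (Fin 3 → EuclideanSpace ℝ (DirFree H))} (hG : MeasurableSet G) {η : ℝ}
    (hη : (Measure.pi fun _ : Fin 3 => boxDirichlet H).real Gᶜ ≤ η) (hη2 : η ≤ 1 / 2) :
    |(∫ t, (1 / 2 : ℝ) * ∑ c, (F c + dirCirc H q (t c)) ^ 2 ∂((Measure.pi fun _ : Fin 3 => boxDirichlet H)[|G])) -
        (3 / 2 * boxDirProjKernel H q q + 1 / 2 * ∑ c, F c ^ 2)| ≤
      2 * (1 + 6 * ∑ c, (F c ^ 4 + 3 * boxDirProjKernel H q q ^ 2)) * Real.sqrt η := by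
  have h1 := abs_integral_sub_integral_cond_le_of_sq (μ := Measure.pi fun _ : Fin 3 => boxDirichlet H) hG
    (memLp_two_quadObs_pi F q) hη hη2
  rw [integral_quadObs_pi_eq, abs_sub_comm] at h1
  refine h1.trans ?_
  have hη0 : 0 ≤ η := le_trans measureReal_nonneg hη
  have h2 := integral_quadObs_sq_pi_le (H := H) F q
  have h3 : 0 ≤ Real.sqrt η := Real.sqrt_nonneg η
  nlinarith

end ThreeColours

/-! ## §4 The form consumed by `KernelMeanExpansion`: data `ϑ_c` and their means -/

section Datum

variable {H : ℕ}

/-- **The Gaussian side of the kernel mean expansion, datum form.**  For one-colour Dirichlet data `ϑ : Fin 3 → (edges → ℝ)`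
(in the assembly: `√(2β)` times the chart coordinates of the small datum on the collar, `0` on the forest) with means
`μ_c = mean ϑ_c` and background circulations `F̄_c(q) = sCirc (glue ϑ_c μ_c) q`, and every measurable `G̃` with `D^{⊗3}(G̃ᶜ) ≤ η ≤ 1/2`:
`|E_{D^{⊗3}}[½Σ_c (sCirc (glue ϑ_c (μ_c + t_c)) q)² | G̃] − (3/2)·boxDirProjKernel H q q − ½Σ_c F̄_c(q)²| ≤ 2(1 + 6Σ_c(F̄_c(q)⁴ + 3V_D(q)²))·√η`. -/
theorem abs_integral_cond_quadObs_datum_sub_le (ϑ : Fin 3 → (Literature.MathematicalPhysics.QuantumLattice.ZdEdge 4 → ℝ)) (q : Plaq 4)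
    {G : Set (Fin 3 → EuclideanSpace ℝ (DirFree H))} (hG : MeasurableSet G) {η : ℝ}
    (hη : (Measure.pi fun _ : Fin 3 => boxDirichlet H).real Gᶜ ≤ η) (hη2 : η ≤ 1 / 2) :
    |(∫ t, (1 / 2 : ℝ) * ∑ c, (sCirc (glue (pin := fun e => e ∉ dirFreeEdges H) dirCorner (2 * H + 3) (ϑ c)
          (mean (fun e => e ∉ dirFreeEdges H) dirCorner (2 * H + 3) (ϑ c) + WithLp.ofLp (t c))) q) ^ 2
          ∂((Measure.pi fun _ : Fin 3 => boxDirichlet H)[|G])) -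
        (3 / 2 * boxDirProjKernel H q q + 1 / 2 * ∑ c, (sCirc (glue (pin := fun e => e ∉ dirFreeEdges H) dirCorner (2 * H + 3)
          (ϑ c) (mean (fun e => e ∉ dirFreeEdges H) dirCorner (2 * H + 3) (ϑ c))) q) ^ 2)| ≤
      2 * (1 + 6 * ∑ c, ((sCirc (glue (pin := fun e => e ∉ dirFreeEdges H) dirCorner (2 * H + 3) (ϑ c)
          (mean (fun e => e ∉ dirFreeEdges H) dirCorner (2 * H + 3) (ϑ c))) q) ^ 4 + 3 * boxDirProjKernel H q q ^ 2)) *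
        Real.sqrt η := by
  simp_rw [sCirc_glue_add_ofLp]
  exact abs_integral_cond_quadObs_sub_le _ q hG hη hη2

/-- **Unrestricted form** (η-free): `E_{D^{⊗3}}[½Σ_c (sCirc (glue ϑ_c (μ_c + t_c)) q)²] = (3/2)·boxDirProjKernel H q q + ½Σ_c F̄_c(q)²`. -/
theorem integral_quadObs_datum_eq (ϑ : Fin 3 → (Literature.MathematicalPhysics.QuantumLattice.ZdEdge 4 → ℝ)) (q : Plaq 4) :
    ∫ t : Fin 3 → EuclideanSpace ℝ (DirFree H), (1 / 2 : ℝ) * ∑ c,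
        (sCirc (glue (pin := fun e => e ∉ dirFreeEdges H) dirCorner (2 * H + 3) (ϑ c)
          (mean (fun e => e ∉ dirFreeEdges H) dirCorner (2 * H + 3) (ϑ c) + WithLp.ofLp (t c))) q) ^ 2
        ∂(Measure.pi fun _ : Fin 3 => boxDirichlet H) =
      3 / 2 * boxDirProjKernel H q q + 1 / 2 * ∑ c, (sCirc (glue (pin := fun e => e ∉ dirFreeEdges H) dirCorner (2 * H + 3)
          (ϑ c) (mean (fun e => e ∉ dirFreeEdges H) dirCorner (2 * H + 3) (ϑ c))) q) ^ 2 := by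
  simp_rw [sCirc_glue_add_ofLp]
  exact integral_quadObs_pi_eq _ q

end Datum

end Summit.QuantumFields.YangMills.Theorems.WeakCouplingRates

end
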